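/-
Copyright: harness cell b2b-lgcu-borel (gen 26).  Honest framing: the VALUE here is a THEOREM
(a decidable NEGATIVE verdict on an infinite slice of the crux: all subgroup triples of
`GL_3(𝔽_p)`, `p ∈ {11, 13, 17, 19}`, below an explicit `ε`) — NOT summit progress; the crux item
`SubgroupIdentityDesigns` (stmt-MatrixMultiplication-14079) stays open and untouched.
-/
import Mathlib
import Summits.MatrixMultiplication.MatrixMultiplication.Theorems.SubgroupIdentityDesigns.Negative.WitnessNeumannCounts
import Summits.MatrixMultiplication.MatrixMultiplication.Theorems.SubgroupIdentityDesigns.Negative.LevelOneFloorAll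

/-!
# The level-one floor at a general exponent (the `ε`-window machinery)

Route `LevelGradedCohnUmans`, crux `SubgroupIdentityDesigns`, negative side; level `k = 1`.

`LevelOneSmallPrimes` closes the level-one slice at every prime `p ≤ 7` for all `0 < ε ≤ 1` and
records why its volume law cannot exclude `p ≥ 11` at `ε = 1`: `max_u (uD − u³ + u²) ≈ 0.385
((p−1)b²)^{3/2}` exceeds the `ε = 1` floor `(p−1)b³ − 3b² + 3b` as soon as `p − 1 > 27/4`.  The
floor used there is the `ℓ³` one.  But the crux inequality `budget p m 1 (2+ε) < V^{(2+ε)/3}` is the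
STRONGER the SMALLER `ε` is, and the level-one degree sum `1 + (b−1)^s + (p−2) b^s ≤ budget`
(`LevelOneExact.budget_ge_exact`) is available at EVERY real exponent `s`:

* `rpow_le_of_le_exp` : `ℓ^s`-monotonicity of the three-term degree sum at a general exponent
  `t ≥ s` (the `t = 3` case is `LevelOneFloorAll.rpow_le_of_le_three`);
* `floor_exp` : **THE LEVEL-ONE FLOOR AT EXPONENT `t`** — in every dimension `1 + l` (`l ≥ 1`), at
  every prime `p`: `budget p (1+l) 1 (2+ε) < V^{(2+ε)/3}` with `−2 < ε` and `2 + ε ≤ t` forces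
  **`1 + (b−1)^t + (p−2) b^t < V^{t/3}`** (no TPP, no design).  At `t = 3` this is the master floor
  of `LevelOneFloorAll`; as `t ↓ 2` the floor rises to `D^{3/2}`;
* `volume_cap` : the volume law `V + u²(u−1) ≤ uD` (`WitnessNeumannCounts.crux_volume_law`) capped
  by its integer maximum `(w₀+1) D − (w₀+1)³ + (w₀+1)²` via the factorisation
  `g(w₀+1) − g(w+1) = (w − w₀)(w² + (w₀+2) w + (w₀+1)² − D)`;
* `quad_trichotomy`, `volume_real`, `cell_absurd` : the arithmetic plumbing of a cell certificate
  (integer trichotomy around the maximiser, the real form of the volume law; the root comparisons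
  `c^d ≤ x^n ⇒ c ≤ x^{n/d}` are `Literature.Barriers.RiemannHypothesis.le_rpow_of_pow_le` /
  `rpow_le_of_pow_le`, reused by the cells file).

The numeric cells — `(3, 11)`, `(3, 13)` closed for `ε ≤ 2/3`, `(3, 17)`, `(3, 19)` for `ε ≤ 1/2` —
are in `LevelOneEpsilonCells`.  In general the method closes `ε ≤ ε₀(p) ≈ 0.85 / log p` and nothing
uniform in `p` — consistent with the route's bet on `p → ∞`.  Sorry-free; standard axioms; no new
definitions.  Report: `run/shared/lean/b2b/levelgraded-cu/ORACLE-g26.md` §G26-1.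
-/

set_option linter.dupNamespace false

noncomputable section

open scoped BigOperators Classical Matrix
open Module (finrank)

namespace Summit.MatrixMultiplication.MatrixMultiplication.Theorems.SubgroupIdentityDesigns.Negative
namespace LevelOneEpsilonFloor

open Literature.Barriers.MatrixMultiplication (SubgroupTPP)
open Summit.MatrixMultiplication.MatrixMultiplication.Theorems.LieRankDesigns.Negative
  (GLm Mat budget)
open Summit.MatrixMultiplication.MatrixMultiplication.Theorems.LevelOneGL2Designs.Negative
  (levelSubmodule)
open LevelOneExact (budget_ge_exact)
-- `rpow_le_rpow_sub_one_mul` lives directly in the `Negative` namespace (LevelOneFloor.lean)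
open LevelOneFloorAll (a_cast b_cast succ_le_b finrank_le_formula_nat)
open WitnessNeumannCounts (crux_volume_law)

/-! ## `ℓ^s`-monotonicity at a general exponent -/

/-- **`ℓ^s`-MONOTONICITY AT EXPONENT `t`.**  For `x, y ≥ 0`, a weight `w = 0` or `w ≥ 1`,
`0 < s ≤ t` and `0 ≤ W ≤ 1 + x^t + w y^t`:  `W^{s/t} ≤ 1 + x^s + w y^s`. -/
theorem rpow_le_of_le_exp {x y w W s t : ℝ} (hx : 0 ≤ x) (hy : 0 ≤ y) (hw : w = 0 ∨ 1 ≤ w)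
    (hW0 : 0 ≤ W) (hW : W ≤ 1 + x ^ t + w * y ^ t) (hs0 : 0 < s) (hst : s ≤ t) :
    W ^ (s / t) ≤ 1 + x ^ s + w * y ^ s := by
  set A : ℝ := 1 + x ^ s + w * y ^ s with hA
  have ht0 : 0 < t := lt_of_lt_of_le hs0 hst
  have hxs : 0 ≤ x ^ s := Real.rpow_nonneg hx s
  have hys : 0 ≤ y ^ s := Real.rpow_nonneg hy s
  have hw0 : 0 ≤ w := by rcases hw with h | h <;> linarith
  have hwys : 0 ≤ w * y ^ s := mul_nonneg hw0 hys
  have h1A : (1 : ℝ) ≤ A := by rw [hA]; linarith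
  have h2A : x ^ s ≤ A := by rw [hA]; linarith
  have hA0 : 0 ≤ A := by linarith
  set r : ℝ := t / s with hr
  have hr1 : 1 ≤ r := by
    rw [hr, le_div_iff₀ hs0]
    linarith
  have hsr : s * r = t := by rw [hr, mul_div_cancel₀ t hs0.ne']
  have e1 : (1 : ℝ) = (1 : ℝ) ^ r := (Real.one_rpow r).symm
  have e2 : x ^ t = (x ^ s) ^ r := by rw [← Real.rpow_mul hx, hsr]
  have e3 : y ^ t = (y ^ s) ^ r := by rw [← Real.rpow_mul hy, hsr]
  have t1 : (1 : ℝ) ^ r ≤ A ^ (r - 1) * 1 := rpow_le_rpow_sub_one_mul zero_le_one h1A hr1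
  have t2 : (x ^ s) ^ r ≤ A ^ (r - 1) * x ^ s := rpow_le_rpow_sub_one_mul hxs h2A hr1
  have t3 : w * (y ^ s) ^ r ≤ w * (A ^ (r - 1) * y ^ s) := by
    rcases hw with h | h
    · rw [h, zero_mul, zero_mul]
    · have h3A : y ^ s ≤ A := by
        have hm : 1 * y ^ s ≤ w * y ^ s := mul_le_mul_of_nonneg_right h hys
        rw [one_mul] at hm
        rw [hA]
        linarith
      exact mul_le_mul_of_nonneg_left (rpow_le_rpow_sub_one_mul hys h3A hr1) hw0
  have key : 1 + x ^ t + w * y ^ t ≤ A ^ r := by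
    have eA : A ^ (r - 1) * A = A ^ r := by
      have h := Real.rpow_add' hA0 (show (r - 1) + 1 ≠ 0 by linarith)
      rw [sub_add_cancel, Real.rpow_one] at h
      exact h.symm
    calc 1 + x ^ t + w * y ^ t
        = (1 : ℝ) ^ r + (x ^ s) ^ r + w * (y ^ s) ^ r := by rw [← e1, ← e2, ← e3]
      _ ≤ A ^ (r - 1) * 1 + A ^ (r - 1) * x ^ s + w * (A ^ (r - 1) * y ^ s) := by linarith
      _ = A ^ (r - 1) * A := by rw [hA]; ring
      _ = A ^ r := eA
  have hrs : r * (s / t) = 1 := by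
    rw [hr, div_mul_div_comm, mul_comm t s]
    exact div_self (mul_ne_zero hs0.ne' ht0.ne')
  calc W ^ (s / t) ≤ (A ^ r) ^ (s / t) :=
        Real.rpow_le_rpow hW0 (hW.trans key) (div_nonneg hs0.le ht0.le)
    _ = A := by rw [← Real.rpow_mul hA0, hrs, Real.rpow_one]

/-- **THE VOLUME CAP.**  `g(u) = uD − u³ + u²` over the integers is at most its value at
`u = w₀ + 1` once the quadratic `q(w) = w² + (w₀+2)w + (w₀+1)² − D` is `≥ 0` for `w ≥ w₀ + 1` and
`≤ 0` for `w ≤ w₀ − 1` (`g(w₀+1) − g(w+1) = (w − w₀)·q(w)`):  from `V + (w+1)² w ≤ (w+1) D'`,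
`D' ≤ D`:  `V ≤ (w₀+1)D − (w₀+1)³ + (w₀+1)²`. -/
theorem volume_cap {V D D' w w₀ : ℝ} (hw0 : 0 ≤ w) (hV : V + (w + 1) * (w + 1) * w ≤ (w + 1) * D')
    (hD : D' ≤ D)
    (hq : (w₀ + 1 ≤ w ∧ 0 ≤ w ^ 2 + (w₀ + 2) * w + ((w₀ + 1) ^ 2 - D)) ∨ w = w₀ ∨
      (w ≤ w₀ - 1 ∧ w ^ 2 + (w₀ + 2) * w + ((w₀ + 1) ^ 2 - D) ≤ 0)) :
    V ≤ (w₀ + 1) * D - (w₀ + 1) ^ 3 + (w₀ + 1) ^ 2 := by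
  have h1 : 0 ≤ (w + 1) * (D - D') := mul_nonneg (by linarith) (sub_nonneg.2 hD)
  rcases hq with ⟨hle, hq⟩ | rfl | ⟨hle, hq⟩
  · nlinarith [mul_nonneg (by linarith : (0 : ℝ) ≤ w - w₀) hq]
  · nlinarith
  · nlinarith [mul_nonneg (by linarith : (0 : ℝ) ≤ w₀ - w) (by linarith : (0 : ℝ) ≤
      -(w ^ 2 + (w₀ + 2) * w + ((w₀ + 1) ^ 2 - D)))]

/-- The integer trichotomy feeding `volume_cap`, with the two one-sided quadratic signs derived from
their values at `w₀ ± 1`. -/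
theorem quad_trichotomy {w w₀ : ℕ} {D : ℝ}
    (hplus : 0 ≤ ((w₀ : ℝ) + 1) ^ 2 + ((w₀ : ℝ) + 2) * ((w₀ : ℝ) + 1) + (((w₀ : ℝ) + 1) ^ 2 - D))
    (hminus : ((w₀ : ℝ) - 1) ^ 2 + ((w₀ : ℝ) + 2) * ((w₀ : ℝ) - 1) + (((w₀ : ℝ) + 1) ^ 2 - D) ≤ 0) :
    ((w₀ : ℝ) + 1 ≤ w ∧ 0 ≤ (w : ℝ) ^ 2 + ((w₀ : ℝ) + 2) * w + (((w₀ : ℝ) + 1) ^ 2 - D)) ∨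
      (w : ℝ) = w₀ ∨
      ((w : ℝ) ≤ (w₀ : ℝ) - 1 ∧ (w : ℝ) ^ 2 + ((w₀ : ℝ) + 2) * w + (((w₀ : ℝ) + 1) ^ 2 - D) ≤ 0) := by
  have hw0 : (0 : ℝ) ≤ w := Nat.cast_nonneg _
  rcases lt_trichotomy w₀ w with h | h | h
  · left
    have hR : (w₀ : ℝ) + 1 ≤ w := by exact_mod_cast (show w₀ + 1 ≤ w by omega)
    exact ⟨hR, by nlinarith [mul_nonneg hw0 (sub_nonneg.2 hR)]⟩
  · right; left
    exact_mod_cast h.symm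
  · right; right
    have h1 : 1 ≤ w₀ := by omega
    have hR : (w : ℝ) ≤ (w₀ : ℝ) - 1 := by
      have h' : ((w : ℕ) : ℝ) + 1 ≤ ((w₀ : ℕ) : ℝ) := by exact_mod_cast (show w + 1 ≤ w₀ by omega)
      linarith
    exact ⟨hR, by nlinarith [mul_nonneg hw0 (sub_nonneg.2 hR)]⟩

/-- From the natural-number volume law to its real form with `u = w + 1` and a numeric `D`-cap. -/
theorem volume_real {u D V Dm : ℕ} (hu1 : 1 ≤ u) (hvol : V + u * u * (u - 1) ≤ u * D)
    (hD : D ≤ Dm) :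
    ∃ w : ℕ, (V : ℝ) + ((w : ℝ) + 1) * ((w : ℝ) + 1) * (w : ℝ) ≤ ((w : ℝ) + 1) * (Dm : ℝ) := by
  obtain ⟨w, rfl⟩ : ∃ w, u = w + 1 := ⟨u - 1, by omega⟩
  refine ⟨w, ?_⟩
  simp only [Nat.add_sub_cancel] at hvol
  have h1 : V + (w + 1) * (w + 1) * w ≤ (w + 1) * Dm :=
    hvol.trans (Nat.mul_le_mul_left _ hD)
  exact_mod_cast h1

/-- **CELL CERTIFICATE (abstract).**  `0 ≤ V ≤ M`, `1 + x^t + w y^t < V^r` (`r ≥ 0`), `c₂ ≤ x^t`,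
`c₁ ≤ y^t`, `w ≥ 0` and `M^r ≤ 1 + c₂ + w c₁` are contradictory. -/
theorem cell_absurd {V M X Y w r c₁ c₂ : ℝ} (hV0 : 0 ≤ V) (hVM : V ≤ M) (hw : 0 ≤ w) (hr : 0 ≤ r)
    (hfl : 1 + X + w * Y < V ^ r) (h2 : c₂ ≤ X) (h1 : c₁ ≤ Y) (hM : M ^ r ≤ 1 + c₂ + w * c₁) :
    False := by
  have hmon : V ^ r ≤ M ^ r := Real.rpow_le_rpow hV0 hVM hr
  nlinarith [mul_le_mul_of_nonneg_left h1 hw]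

/-! ## The level-one floor at a general exponent -/

variable {p : ℕ} [hp : Fact p.Prime] {l : ℕ}

/-- **THE LEVEL-ONE FLOOR AT EXPONENT `t`** (`l ≥ 1`, any prime `p`, `−2 < ε`, `2 + ε ≤ t`): the crux
inequality `budget p (1+l) 1 (2+ε) < V^{(2+ε)/3}` forces `1 + (b−1)^t + (p−2) b^t < V^{t/3}`. -/
theorem floor_exp (hl : 1 ≤ l) {ε t : ℝ} (hε : -2 < ε) (hεt : 2 + ε ≤ t)
    {H₁ H₂ H₃ : Subgroup (GLm p (1 + l))}
    (hlt : budget p (1 + l) 1 (2 + ε) <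
      ((Nat.card H₁ * Nat.card H₂ * Nat.card H₃ : ℕ) : ℝ) ^ ((2 + ε) / 3)) :
    1 + ((((p ^ (1 + l) - 1) / (p - 1) : ℕ) : ℝ) - 1) ^ t +
        ((p : ℝ) - 2) * (((p ^ (1 + l) - 1) / (p - 1) : ℕ) : ℝ) ^ t <
      (((Nat.card H₁ * Nat.card H₂ * Nat.card H₃ : ℕ) : ℝ)) ^ (t / 3) := by
  have hp2 : 2 ≤ p := hp.out.two_le
  have hpR : (2 : ℝ) ≤ p := by exact_mod_cast hp2
  set bR : ℝ := (((p ^ (1 + l) - 1) / (p - 1) : ℕ) : ℝ) with hbR_def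
  have hb1 : (p : ℝ) + 1 ≤ bR := by
    rw [hbR_def]
    exact_mod_cast succ_le_b (p := p) hl
  have hx : (0 : ℝ) ≤ bR - 1 := by linarith
  have hy : (0 : ℝ) ≤ bR := by linarith
  have hw : (p : ℝ) - 2 = 0 ∨ 1 ≤ (p : ℝ) - 2 := by
    rcases Nat.lt_or_ge p 3 with h | h
    · left
      have : p = 2 := by omega
      subst this
      norm_num
    · right
      have : (3 : ℝ) ≤ p := by exact_mod_cast h
      linarith
  have hs0 : 0 < 2 + ε := by linarith
  have ht0 : 0 < t := by linarith
  by_contra hcon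
  push Not at hcon
  set V : ℝ := ((Nat.card H₁ * Nat.card H₂ * Nat.card H₃ : ℕ) : ℝ) with hV_def
  have hV0 : 0 ≤ V := Nat.cast_nonneg _
  have hW0 : 0 ≤ V ^ (t / 3) := Real.rpow_nonneg hV0 _
  have hmono := rpow_le_of_le_exp hx hy hw hW0 hcon hs0 hεt
  have e : (V ^ (t / 3)) ^ ((2 + ε) / t) = V ^ ((2 + ε) / 3) := by
    rw [← Real.rpow_mul hV0]
    congr 1
    rw [div_mul_div_comm, mul_comm t (2 + ε)]
    exact mul_div_mul_right (2 + ε) 3 ht0.ne'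
  rw [e] at hmono
  have hfloor := budget_ge_exact (p := p) hl (2 + ε)
  rw [a_cast, b_cast.symm] at hfloor
  exact absurd (hmono.trans hfloor) (not_le.2 hlt)

end LevelOneEpsilonFloor

end Summit.MatrixMultiplication.MatrixMultiplication.Theorems.SubgroupIdentityDesigns.Negative
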